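import Summits.ABC.ABC.Theorems.DefiniteXiDefiniteRTControlPrimeOfTakahashiGlue
import Summits.ABC.ABC.Theorems.DefiniteXiDefiniteRTControlPrimeCyclicDegreeFrobNorm
import HarnessLib

/-!
# Crux `DefiniteRTControlPrime` from Takahashi 2.3 alone — part 7/7: the counting end and the final theorem

SUB (`freyIsogenyRadiusSubpoly_of_sq`): from part 4's `CyclicDegreeDvdFrobNormSq`, Hasse
(`0 < frobNorm ≤ (p⁶+1)²`), two distinct odd primes `p₀, p₁ ∤ N` below `6 log N + B`
(`exists_two_odd_primes_not_dvd_le_log`) and `(log N)^48 ≤ R_ε N^ε`, every curve `ℚ`-isogenous to a Frey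
curve is reached by an isogeny of degree `≤ R_ε N^ε` — `freyIsogenyRadiusSubpoly : FreyIsogenyRadiusSubpoly`,
UNCONDITIONALLY.  With part 6: **`definiteRTControlPrime_of_takahashi (hT : takahashi2001_thm_2_3_of_coprime) :
DefiniteRTControlPrime`** — the crux's only remaining debt is Takahashi 2001 Thm 2.3 (coprime form); the
`N^ε` of the crux absorbs the polylogarithmic isogeny radius, so Mazur–Kenku's uniform `163` is not needed.
Continues `DefiniteXiDefiniteRTControlPrimeOfTakahashiGlue` and `DefiniteXiDefiniteRTControlPrimeCyclicDegreeFrobNorm`.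

Origin: crux programme of stmt-ABC-11338, kernel certificate `Cruxes/DefiniteRTControlPrime/StubIdeasK2G11CruxFromTakahashi.lean` (stub-ideation k2, gens 2–11; farm `lean check` rc 0, 0 sorries, axioms propext/Classical.choice/Quot.sound), re-packaged verbatim into seven `≤ 400`-line modules by k2 gen 12 (namespaces `…Theorems.DefiniteRTControlPrime.CyclicCharacter` / `.OfTakahashi`; statements and proofs unchanged).

## References

* [Mazur1978] B. Mazur, Rational isogenies of prime degree, Invent. Math. 44 (1978) 129–162, §5 (isogeny characters), Lemma 5.2–5.4.
* [Serre1972] J.-P. Serre, Propriétés galoisiennes des points d'ordre fini des courbes elliptiques, Invent. Math. 15 (1972), §1.11–1.12, §5.4 Prop. 21.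
* [SilvermanATAEC1994] J. H. Silverman, Advanced Topics in the Arithmetic of Elliptic Curves, GTM 151, Thm. V.5.3, Cor. V.5.4, Prop. V.6.1 (Tate curve, Galois action).
* [Takahashi2001] S. Takahashi, Degrees of parametrizations of elliptic curves by Shimura curves, J. Number Theory 90 (2001) 74–88, Thm. 2.3 (p. 79).
* [PastenShimura2024] H. Pasten, Shimura curves and the abc conjecture, J. Number Theory 254 (2024) 214–335 = arXiv:1705.09251, §3 p. 13, §6.4, Lemma 6.8.
-/

set_option linter.dupNamespace false

namespace Summit.ABC.ABC.Theorems.DefiniteRTControlPrime.OfTakahashi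

open Literature.NumberTheory.EllipticCurves Literature.NumberTheory.EllipticCurves.ModularForms
open Literature.NumberTheory.GaloisRepresentations Literature.NumberTheory.EllipticCurves.TateCurve
open WeierstrassCurve IsDedekindDomain IsDedekindDomain.HeightOneSpectrum NumberField Field
open scoped NumberField NNReal Classical
open Summit.ABC.ABC.Theorems.DefiniteRTControlPrime.CyclicCharacter

/-! ## §9 THE COUNTING END (gen 11): SUB `freyIsogenyRadiusSubpoly_of_sq` PROVED

With §8 this closes the whole k2 RESHAPE line modulo `stub_takahashi`:
`definiteRTControlPrime_of_freyIsogenyRadiusSubpoly stub_takahashi (freyIsogenyRadiusSubpoly_of_sq cyclicDegreeDvdFrobNormSq)`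
(consumer PROVED in `StubIdeasK2G5PastenLemma68.lean`, k2-g5). -/

section Counting

open Rat.HeightOneSpectrum Literature.NumberTheory.DiophantineGeometry

/-- The integer power-trace recursion `Mazur1978.frobTracePow` cast to `ℂ` agrees with the complex one. -/
theorem cast_frobTracePow (t : ℤ) (q : ℕ) :
    ∀ n : ℕ, ((Mazur1978.frobTracePow t q n : ℤ) : ℂ) = frobTracePow (t : ℂ) (q : ℂ) n
  | 0 => by simp
  | 1 => by simp
  | n + 2 => by
    rw [Mazur1978.frobTracePow_add_two]
    show _ = (t : ℂ) * frobTracePow (t : ℂ) (q : ℂ) (n + 1) - (q : ℂ) * frobTracePow (t : ℂ) (q : ℂ) n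
    push_cast
    rw [cast_frobTracePow t q n, cast_frobTracePow t q (n + 1)]

/-- SUB-c2 (Hasse, via `frobeniusTrace_sq_le_four_mul` + `norm_frobTracePow_le_of_sq_le`):
`|s₁₂(a_p, p)| ≤ 2p⁶`. -/
theorem abs_frobTracePow_twelve_le (W : WeierstrassCurve ℚ) [W.IsElliptic] [W.IsGloballyMinimal]
    (p : ℕ) [Fact p.Prime] (hgood : W.HasGoodReductionAtPrime p) :
    |Mazur1978.frobTracePow (W.frobeniusTrace p) p 12| ≤ 2 * (p : ℤ) ^ 6 := by
  have ha : W.frobeniusTrace p ^ 2 ≤ 4 * (p : ℤ) := W.frobeniusTrace_sq_le_four_mul p hgood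
  have h := norm_frobTracePow_le_of_sq_le ha 12
  rw [← cast_frobTracePow, Complex.norm_intCast] at h
  have hsqrt : Real.sqrt (p : ℝ) ^ 12 = (p : ℝ) ^ 6 := by
    rw [show (12 : ℕ) = 2 * 6 from rfl, pow_mul, Real.sq_sqrt (Nat.cast_nonneg p)]
  rw [hsqrt] at h
  have h' : ((|Mazur1978.frobTracePow (W.frobeniusTrace p) p 12| : ℤ) : ℝ) ≤ 2 * (p : ℝ) ^ 6 := by
    rw [Int.cast_abs]; exact h
  exact_mod_cast h'

/-- SUB-c3: `0 < n₁₂(p) ≤ (p⁶ + 1)²`. -/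
theorem frobNorm_pos_and_le (W : WeierstrassCurve ℚ) [W.IsElliptic] [W.IsGloballyMinimal]
    (p : ℕ) [Fact p.Prime] (hgood : W.HasGoodReductionAtPrime p) :
    0 < frobNorm W p ∧ frobNorm W p ≤ ((p : ℤ) ^ 6 + 1) ^ 2 := by
  have h := abs_frobTracePow_twelve_le W p hgood
  rw [abs_le] at h
  have hp2 : (2 : ℤ) ≤ p := by exact_mod_cast (Fact.out : p.Prime).two_le
  have hp6 : (64 : ℤ) ≤ (p : ℤ) ^ 6 := by
    calc (64 : ℤ) = 2 ^ 6 := by norm_num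
      _ ≤ (p : ℤ) ^ 6 := pow_le_pow_left₀ (by norm_num) hp2 6
  have h12 : (p : ℤ) ^ 12 = ((p : ℤ) ^ 6) ^ 2 := by ring
  unfold frobNorm
  constructor
  · nlinarith [h.1, h.2, hp6, h12, sq_nonneg ((p : ℤ) ^ 6 - 1)]
  · nlinarith [h.1, h.2, h12]

/-- SUB-b: two small odd primes outside `N` (`exists_prime_not_dvd_le_log` at `2N` and `2Np₀`,
`log p₀ ≤ p₀`). -/
theorem exists_two_odd_primes_not_dvd_le_log :
    ∃ B : ℝ, ∀ N : ℕ, N ≠ 0 → ∃ p₀ p₁ : ℕ, p₀.Prime ∧ p₁.Prime ∧ p₀ ≠ 2 ∧ p₁ ≠ 2 ∧ p₀ ≠ p₁ ∧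
      ¬ p₀ ∣ N ∧ ¬ p₁ ∣ N ∧ (p₀ : ℝ) ≤ 6 * Real.log N + B ∧ (p₁ : ℝ) ≤ 6 * Real.log N + B := by
  obtain ⟨C, hC⟩ := exists_prime_not_dvd_le_log
  refine ⟨6 + 3 * |C|, fun N hN => ?_⟩
  have hlogN : 0 ≤ Real.log N := Real.log_natCast_nonneg N
  have hCabs : C ≤ |C| := le_abs_self C
  have hlog2 : Real.log 2 ≤ 1 := by
    have := Real.log_le_sub_one_of_pos (show (0 : ℝ) < 2 by norm_num); linarith
  have hN' : (N : ℝ) ≠ 0 := Nat.cast_ne_zero.mpr hN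
  -- `p₀`
  obtain ⟨p₀, hp₀, hp₀N, hp₀le⟩ := hC (2 * N) (mul_ne_zero two_ne_zero hN)
  have hp₀2 : p₀ ≠ 2 := fun h => hp₀N (by rw [h]; exact dvd_mul_right 2 N)
  have hp₀N' : ¬ p₀ ∣ N := fun h => hp₀N (dvd_mul_of_dvd_right h 2)
  have hlog2N : Real.log ((2 * N : ℕ) : ℝ) = Real.log 2 + Real.log N := by
    push_cast
    rw [Real.log_mul (by norm_num) hN']
  have hp₀bd : (p₀ : ℝ) ≤ 2 * Real.log N + 2 + |C| := by
    rw [hlog2N] at hp₀le; linarith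
  -- `p₁`
  obtain ⟨p₁, hp₁, hp₁N, hp₁le⟩ :=
    hC (2 * N * p₀) (mul_ne_zero (mul_ne_zero two_ne_zero hN) hp₀.ne_zero)
  have hp₁2 : p₁ ≠ 2 := fun h => hp₁N (by rw [h]; exact (dvd_mul_right 2 N).mul_right p₀)
  have hp₁N' : ¬ p₁ ∣ N := fun h => hp₁N ((dvd_mul_of_dvd_right h 2).mul_right p₀)
  have hp01 : p₀ ≠ p₁ := fun h => hp₁N (by rw [← h]; exact dvd_mul_left p₀ (2 * N))
  have hp₀pos : (0 : ℝ) < p₀ := by exact_mod_cast hp₀.pos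
  have hlogp₀ : Real.log p₀ ≤ p₀ := by
    have := Real.log_le_sub_one_of_pos hp₀pos; linarith
  have hlog2Np : Real.log ((2 * N * p₀ : ℕ) : ℝ) = Real.log 2 + Real.log N + Real.log p₀ := by
    push_cast
    rw [Real.log_mul (mul_ne_zero two_ne_zero hN') hp₀pos.ne', Real.log_mul (by norm_num) hN']
  have hp₁bd : (p₁ : ℝ) ≤ 6 * Real.log N + 6 + 3 * |C| := by
    rw [hlog2Np] at hp₁le; linarith
  exact ⟨p₀, p₁, hp₀, hp₁, hp₀2, hp₁2, hp01, hp₀N', hp₁N', by linarith, by linarith⟩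

/-- SUB-d: `16 · ((x⁶+1)²(y⁶+1)²)² ≤ R_ε N^ε` for `x, y ≤ 6 log N + B` (`log N ≤ N^δ/δ`, `δ = ε/48`). -/
theorem exists_const_log_pow_le_rpow (ε : ℝ) (hε : 0 < ε) (B : ℝ) :
    ∃ R : ℝ, ∀ N : ℕ, N ≠ 0 → ∀ x y : ℝ, 0 ≤ x → x ≤ 6 * Real.log N + B → 0 ≤ y →
      y ≤ 6 * Real.log N + B →
      16 * ((x ^ 6 + 1) ^ 2 * (y ^ 6 + 1) ^ 2) ^ 2 ≤ R * (N : ℝ) ^ ε := by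
  set δ : ℝ := ε / 48 with hδ
  have hδpos : 0 < δ := by positivity
  set K : ℝ := 6 / δ + |B| + 1 with hK
  have hKpos : 0 < K := by positivity
  refine ⟨4096 * K ^ 48, fun N hN x y hx hxle hy hyle => ?_⟩
  have hN1 : (1 : ℝ) ≤ N := by exact_mod_cast Nat.one_le_iff_ne_zero.mpr hN
  have hN0 : (0 : ℝ) ≤ N := Nat.cast_nonneg N
  have hNd : 1 ≤ (N : ℝ) ^ δ := Real.one_le_rpow hN1 hδpos.le
  have hlog : Real.log N ≤ (N : ℝ) ^ δ / δ := Real.log_le_rpow_div hN0 hδpos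
  have hlogN : 0 ≤ Real.log N := Real.log_natCast_nonneg N
  set L : ℝ := 6 * Real.log N + |B| + 1 with hL
  have hBabs : B ≤ |B| := le_abs_self B
  have hBabs0 : 0 ≤ |B| := abs_nonneg B
  have hL1 : 1 ≤ L := by rw [hL]; linarith
  have hL0 : 0 ≤ L := le_trans zero_le_one hL1
  have hxL : x ≤ L := by rw [hL]; linarith
  have hyL : y ≤ L := by rw [hL]; linarith
  have hLK : L ≤ K * (N : ℝ) ^ δ := by
    have h1 : Real.log N * δ ≤ (N : ℝ) ^ δ := (le_div_iff₀ hδpos).mp hlog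
    have h1' : 6 * Real.log N ≤ 6 / δ * (N : ℝ) ^ δ := by
      rw [div_mul_eq_mul_div, le_div_iff₀ hδpos]; linarith
    have h2 : |B| + 1 ≤ (|B| + 1) * (N : ℝ) ^ δ := le_mul_of_one_le_right (by positivity) hNd
    have hexp : K * (N : ℝ) ^ δ = 6 / δ * (N : ℝ) ^ δ + (|B| + 1) * (N : ℝ) ^ δ := by
      rw [hK]; ring
    rw [hexp, hL]; linarith
  have hexp : δ * ((48 : ℕ) : ℝ) = ε := by rw [hδ]; push_cast; ring
  clear_value L K δ
  have hL6 : 1 ≤ L ^ 6 := one_le_pow₀ hL1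
  have hx6 : x ^ 6 + 1 ≤ 2 * L ^ 6 := by
    have : x ^ 6 ≤ L ^ 6 := pow_le_pow_left₀ hx hxL 6
    linarith
  have hy6 : y ^ 6 + 1 ≤ 2 * L ^ 6 := by
    have : y ^ 6 ≤ L ^ 6 := pow_le_pow_left₀ hy hyL 6
    linarith
  have hmain : 16 * ((x ^ 6 + 1) ^ 2 * (y ^ 6 + 1) ^ 2) ^ 2 ≤
      16 * ((2 * L ^ 6) ^ 2 * (2 * L ^ 6) ^ 2) ^ 2 := by
    gcongr
  have h16 : 16 * ((2 * L ^ 6) ^ 2 * (2 * L ^ 6) ^ 2) ^ 2 = 4096 * L ^ 48 := by ring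
  have hL48 : L ^ 48 ≤ (K * (N : ℝ) ^ δ) ^ 48 := pow_le_pow_left₀ hL0 hLK 48
  have hKN : (K * (N : ℝ) ^ δ) ^ 48 = K ^ 48 * (N : ℝ) ^ ε := by
    rw [mul_pow, ← Real.rpow_natCast ((N : ℝ) ^ δ) 48, ← Real.rpow_mul hN0, hexp]
  calc 16 * ((x ^ 6 + 1) ^ 2 * (y ^ 6 + 1) ^ 2) ^ 2 ≤ 4096 * L ^ 48 := by rw [← h16]; exact hmain
    _ ≤ 4096 * (K * (N : ℝ) ^ δ) ^ 48 := by linarith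
    _ = 4096 * K ^ 48 * (N : ℝ) ^ ε := by rw [hKN, mul_assoc]

/-- SUB-e: precomposing with a change of model does not change the degree. -/
theorem degree_comp_toIsogeny {W W' : WeierstrassCurve ℚ} (C : VariableChange ℚ)
    (ψ : Isogeny (C • W) W') : (ψ.comp (VariableChange.toIsogeny W C)).degree = ψ.degree := by
  unfold Isogeny.degree
  rw [Isogeny.ker_comp]
  exact Nat.card_congr
    ((VariableChange.pointEquivBaseChange W C (AlgebraicClosure ℚ)).toEquiv.subtypeEquiv
      fun P => Iff.rfl)

/-- **SUB (PROVED).**  `CyclicDegreeDvdFrobNormSq → FreyIsogenyRadiusSubpoly`: Néron model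
`C • E_(a,b)` (`hasGlobalMinimalModel_rat_holds`), semistable away from `2`
(`isSemistableAt_freyCurve_holds` + `hasGoodReductionAt_of_int`/`hasMultiplicativeReductionAt_of_int` +
`isSemistableAt_smul_iff_holds`), a CYCLIC isogeny `C • E → W'` (`IsIsogenous.exists_isCyclic`), two odd
primes `p₀ ≠ p₁ ∤ N` of size `O(log N)` (SUB-b), good there (`conductorNorm_smul_rat`,
`hasGoodReductionAtPrime_of_not_dvd_conductorNorm'`), C0², `0 < n₁₂(p) ≤ (p⁶+1)²` (SUB-c), SUB-d, and the
degree-`1` change of model (SUB-e). -/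
theorem freyIsogenyRadiusSubpoly_of_sq (h0 : CyclicDegreeDvdFrobNormSq) :
    FreyIsogenyRadiusSubpoly := by
  intro ε hε
  obtain ⟨B, hB⟩ := exists_two_odd_primes_not_dvd_le_log
  obtain ⟨R, hR⟩ := exists_const_log_pow_le_rpow ε hε B
  refine ⟨R, fun a b hab h0ab q _ _ _ W' _ hW' => ?_⟩
  haveI hEell : (freyCurve a b).IsElliptic := isElliptic_freyCurve h0ab
  obtain ⟨C, hC⟩ := hasGlobalMinimalModel_rat_holds (freyCurve a b)
  haveI : (C • freyCurve a b).IsGloballyMinimal := hC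
  have hN0 : (freyCurve a b).conductorNorm ℤ ≠ 0 := (conductorNorm_pos_holds (freyCurve a b)).ne'
  obtain ⟨p₀, p₁, hp₀, hp₁, hp₀2, hp₁2, hp01, hp₀N, hp₁N, hp₀le, hp₁le⟩ := hB _ hN0
  haveI := Fact.mk hp₀
  haveI := Fact.mk hp₁
  -- good reduction of the Néron model at `p ∤ N`
  have hgood : ∀ (p : ℕ) [Fact p.Prime], ¬ p ∣ (freyCurve a b).conductorNorm ℤ →
      (C • freyCurve a b).HasGoodReductionAtPrime p := by
    intro p _ hpN
    refine hasGoodReductionAtPrime_of_not_dvd_conductorNorm' (C • freyCurve a b) ?_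
    rwa [conductorNorm_smul_rat]
  -- semistability of the Néron model away from `2`
  have hss : ∀ v : HeightOneSpectrum (𝓞 ℚ), (2 : 𝓞 ℚ) ∉ v.asIdeal →
      (C • freyCurve a b).IsSemistableAt v := by
    intro v h2
    obtain ⟨ℓ, rfl⟩ : ∃ ℓ : Nat.Primes, v = primesEquiv.symm ℓ :=
      ⟨primesEquiv v, (Equiv.symm_apply_apply _ _).symm⟩
    have hgenQ : natGenerator ((primesEquiv (R := 𝓞 ℚ)).symm ℓ) = (ℓ : ℕ) :=
      congrArg Subtype.val ((primesEquiv (R := 𝓞 ℚ)).apply_symm_apply ℓ)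
    have hℓ2 : (ℓ : ℕ) ≠ 2 := by
      intro h
      apply h2
      have hmem := natCast_natGenerator_mem ((primesEquiv (R := 𝓞 ℚ)).symm ℓ)
      rw [hgenQ, h] at hmem
      exact_mod_cast hmem
    have hgenZ : natGenerator ((primesEquiv (R := ℤ)).symm ℓ) = (ℓ : ℕ) :=
      congrArg Subtype.val ((primesEquiv (R := ℤ)).apply_symm_apply ℓ)
    have hssZ : (freyCurve a b).IsSemistableAt ((primesEquiv (R := ℤ)).symm ℓ) :=
      isSemistableAt_freyCurve_holds a b hab h0ab _ (by rw [hgenZ]; exact hℓ2)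
    have hssQ : (freyCurve a b).IsSemistableAt ((primesEquiv (R := 𝓞 ℚ)).symm ℓ) := by
      rcases hssZ with hg | hm
      · exact Or.inl (hasGoodReductionAt_of_int (freyCurve a b) ℓ hg)
      · exact Or.inr (hasMultiplicativeReductionAt_of_int (freyCurve a b) ℓ hm)
    exact (isSemistableAt_smul_iff_holds _ (freyCurve a b) C).mpr hssQ
  -- a cyclic isogeny out of the Néron model, and C0²
  obtain ⟨ψ, hψ⟩ := (IsIsogenous.trans' (isIsogenous_of_smul (freyCurve a b) C) hW').exists_isCyclic
  have hdvd := h0 (C • freyCurve a b) W' hss ψ hψ p₀ p₁ hp₀2 hp₁2 hp01 (hgood p₀ hp₀N)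
    (hgood p₁ hp₁N)
  obtain ⟨hn₀pos, hn₀le⟩ := frobNorm_pos_and_le (C • freyCurve a b) p₀ (hgood p₀ hp₀N)
  obtain ⟨hn₁pos, hn₁le⟩ := frobNorm_pos_and_le (C • freyCurve a b) p₁ (hgood p₁ hp₁N)
  set n : ℕ := (frobNorm (C • freyCurve a b) p₀ * frobNorm (C • freyCurve a b) p₁).natAbs with hn
  have hnpos : 0 < n := Int.natAbs_pos.mpr (mul_ne_zero hn₀pos.ne' hn₁pos.ne')
  have hnZ : (n : ℤ) = frobNorm (C • freyCurve a b) p₀ * frobNorm (C • freyCurve a b) p₁ := by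
    rw [hn, Int.natAbs_of_nonneg (mul_nonneg hn₀pos.le hn₁pos.le)]
  have hnle : (n : ℝ) ≤ ((p₀ : ℝ) ^ 6 + 1) ^ 2 * ((p₁ : ℝ) ^ 6 + 1) ^ 2 := by
    have h : (n : ℤ) ≤ ((p₀ : ℤ) ^ 6 + 1) ^ 2 * ((p₁ : ℤ) ^ 6 + 1) ^ 2 := by
      rw [hnZ]; exact mul_le_mul hn₀le hn₁le hn₁pos.le (by positivity)
    have h' : ((n : ℤ) : ℝ) ≤ ((((p₀ : ℤ) ^ 6 + 1) ^ 2 * ((p₁ : ℤ) ^ 6 + 1) ^ 2 : ℤ) : ℝ) := by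
      exact_mod_cast h
    push_cast at h'
    exact h'
  have hdeg : (ψ.degree : ℝ) ≤ 16 * (n : ℝ) ^ 2 := by
    have h : ψ.degree ≤ 16 * n ^ 2 := Nat.le_of_dvd (Nat.mul_pos (by norm_num) (pow_pos hnpos 2)) hdvd
    exact_mod_cast h
  refine ⟨ψ.comp (VariableChange.toIsogeny (freyCurve a b) C), ?_⟩
  rw [degree_comp_toIsogeny]
  calc (ψ.degree : ℝ) ≤ 16 * (n : ℝ) ^ 2 := hdeg
    _ ≤ 16 * (((p₀ : ℝ) ^ 6 + 1) ^ 2 * ((p₁ : ℝ) ^ 6 + 1) ^ 2) ^ 2 := by gcongr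
    _ ≤ R * (((freyCurve a b).conductorNorm ℤ : ℕ) : ℝ) ^ ε :=
      hR _ hN0 p₀ p₁ (Nat.cast_nonneg _) hp₀le (Nat.cast_nonneg _) hp₁le

/-- **THE k2 RESHAPE OUTPUT, UNCONDITIONAL (gen 11).** -/
theorem freyIsogenyRadiusSubpoly : FreyIsogenyRadiusSubpoly :=
  freyIsogenyRadiusSubpoly_of_sq cyclicDegreeDvdFrobNormSq

end Counting

end Summit.ABC.ABC.Theorems.DefiniteRTControlPrime.OfTakahashi

namespace Summit.ABC.ABC.Theorems.DefiniteRTControlPrime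

open Literature.NumberTheory.EllipticCurves Literature.NumberTheory.EllipticCurves.ModularForms
open Summit.ABC.ABC.Theses.DefiniteXi

/-- **`DefiniteRTControlPrime` from Takahashi's Theorem 2.3 (coprime form) ALONE** — no Mazur–Kenku, no
Pasten Lemma 6.8, no Pasten `163·δ`: the sub-polynomial rooted isogeny radius of the Frey class
(`OfTakahashi.freyIsogenyRadiusSubpoly`, unconditional) fed to the one-isogeny re-glue
`definiteRTControlPrime_of_freyIsogenyRadiusSubpoly`. [cite: Takahashi2001, Thm. 2.3 (p. 79)] -/
theorem definiteRTControlPrime_of_takahashi (hT : takahashi2001_thm_2_3_of_coprime) :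
    DefiniteRTControlPrime :=
  definiteRTControlPrime_of_freyIsogenyRadiusSubpoly hT OfTakahashi.freyIsogenyRadiusSubpoly

end Summit.ABC.ABC.Theorems.DefiniteRTControlPrime
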